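import Mathlib
import Summits.ValiantsHypothesis.ValiantsHypothesis.Theorems.RigidityForcesSymmetryRankRigidMinimalReprLaplaceFiveStarExchange

/-!
# ValiantsHypothesis / RigidityForcesSymmetry — crux `LaplaceOptimalFive` (stmt-ValiantsHypothesis-24813), crux idea
`young-shadow` (K1) on the star: **(L3-iii) THE COMMON SLACK: `Σ_j H_j = P₅ + 4E` IN LETTER CURRENCY**
(memo `NOTE-p4g15-24813-K1-star.md` §2 (FACT 2.3 / CONSEQUENCE 2.4); memo `NOTE-p4g16-24813-LemmaK-kernel.md` §2 (L3-iii))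

Four letter tensors `H₁,…,H₄` (the shadows of the star splits `{p,a},{p,b},{p,c},{p,d}` read at their own split: two short letters,
three long letters), each side-symmetric and CLOSED (exchange identity, ✓ `star_shadow_exchange`), pairwise CONGRUENT (`H_j − H₁`
fully symmetric, ✓ `star_shadows_congruent`) and summing to the pattern along the fibre (`Σ_j Z_j = P₅`).  With the explicit slack
`E(a,b|c,d,e) := H₁(a,b|c,d,e) − (1/10)·Σ_{pairs} H₁(pair|rest)` (✓ `closed_vertex_sum`: its vertex sums vanish):

* `slack_vertex_sum` — `E(a,b|…) + E(a,c|…) + E(a,d|…) + E(a,e|…) = 0`;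
* `pairSum_cross` — the pair sum `S = Σ_{pairs} H(pair|rest)` is invariant under the cross transposition of letters;
* ★ `star_slack_sum` — `H₁ + H₂ + H₃ + H₄ = P₅ + 4E` entrywise (`P₅(a,…,e) = [letters distinct]`).

Pure finite identities; no definitions, no `sorry`.  Honest framing: (L3) plumbing, closes nothing; the column-space count (L3-iv) and
the rank bounds (L1) remain; K1-on-the-star PAPER PASS, not kernel; `LaplaceOptimalFive` OPEN · CONTESTED 72/120; `VP ≠ VNP` NOT proved.
-/

set_option linter.dupNamespace false

namespace Summit.ValiantsHypothesis.ValiantsHypothesis.Theorems.RigidityForcesSymmetryRankRigidMinimalRepr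

namespace LaplaceFiveStar

open Finset

/-- The pair sum `S(a,b,c,d,e) = Σ_{pairs} H(pair | rest)` of a side-symmetric letter tensor is invariant under the cross
transposition `b ↔ c`. [folklore] -/
theorem pairSum_cross (H : Fin 5 → Fin 5 → Fin 5 → Fin 5 → Fin 5 → ℂ)
    (h12 : ∀ a b c d e : Fin 5, H a b c d e = H b a c d e) (h34 : ∀ a b c d e : Fin 5, H a b c d e = H a b d c e)
    (h45 : ∀ a b c d e : Fin 5, H a b c d e = H a b c e d) (a b c d e : Fin 5) :
    (H a b c d e + H a c b d e + H a d b c e + H a e b c d + H b c a d e + H b d a c e + H b e a c d + H c d a b e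
      + H c e a b d + H d e a b c)
    = (H a c b d e + H a b c d e + H a d c b e + H a e c b d + H c b a d e + H c d a b e + H c e a b d + H b d a c e
      + H b e a c d + H d e a c b) := by
  have e1 : H a d c b e = H a d b c e := h34 a d c b e
  have e2 : H a e c b d = H a e b c d := h34 a e c b d
  have e3 : H c b a d e = H b c a d e := h12 c b a d e
  have e4 : H d e a c b = H d e a b c := h45 d e a c b
  linear_combination -e1 - e2 - e3 - e4

/-- **`Σ_j H_j = P + 4E` (letter currency).**  `H₁` side-symmetric and closed (exchange identity); `H₂, H₃, H₄` side-symmetric and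
CONGRUENT to `H₁` (the differences are invariant under the cross transposition); along the fibre
`H₁(a,b|c,d,e) + H₂(a,c|b,d,e) + H₃(a,d|b,c,e) + H₄(a,e|b,c,d) = P(a,b,c,d,e)`.  Then, entrywise at the SAME letters,
`H₁ + H₂ + H₃ + H₄ = P + 4·E` with the explicit slack `E = H₁ − (1/10)·Σ_{pairs} H₁(pair|rest)`. [folklore] -/
theorem star_slack_sum (H₁ H₂ H₃ H₄ P : Fin 5 → Fin 5 → Fin 5 → Fin 5 → Fin 5 → ℂ)
    (h12 : ∀ a b c d e : Fin 5, H₁ a b c d e = H₁ b a c d e) (h34 : ∀ a b c d e : Fin 5, H₁ a b c d e = H₁ a b d c e)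
    (h45 : ∀ a b c d e : Fin 5, H₁ a b c d e = H₁ a b c e d)
    (hC : ∀ A B C D E : Fin 5, H₁ A B C D E + H₁ A C B D E + H₁ A D C B E + H₁ A E C D B
      = H₁ B A C D E + H₁ B C A D E + H₁ B D C A E + H₁ B E C D A)
    (h34₃ : ∀ a b c d e : Fin 5, H₃ a b c d e = H₃ a b d c e)
    (h34₄ : ∀ a b c d e : Fin 5, H₄ a b c d e = H₄ a b d c e) (h45₄ : ∀ a b c d e : Fin 5, H₄ a b c d e = H₄ a b c e d)
    (hD₂ : ∀ a b c d e : Fin 5, H₂ a b c d e - H₁ a b c d e = H₂ a c b d e - H₁ a c b d e)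
    (hD₃ : ∀ a b c d e : Fin 5, H₃ a b c d e - H₁ a b c d e = H₃ a c b d e - H₁ a c b d e)
    (hD₄ : ∀ a b c d e : Fin 5, H₄ a b c d e - H₁ a b c d e = H₄ a c b d e - H₁ a c b d e)
    (hfib : ∀ a b c d e : Fin 5, H₁ a b c d e + H₂ a c b d e + H₃ a d b c e + H₄ a e b c d = P a b c d e)
    (a b c d e : Fin 5) :
    H₁ a b c d e + H₂ a b c d e + H₃ a b c d e + H₄ a b c d e
      = P a b c d e + 4 * (H₁ a b c d e - (1 / 10 : ℂ) * (H₁ a b c d e + H₁ a c b d e + H₁ a d b c e + H₁ a e b c d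
          + H₁ b c a d e + H₁ b d a c e + H₁ b e a c d + H₁ c d a b e + H₁ c e a b d + H₁ d e a b c)) := by
  have hv := closed_vertex_sum H₁ h12 h34 h45 hC a b c d e
  have d2 : H₂ a c b d e - H₁ a c b d e = H₂ a b c d e - H₁ a b c d e := (hD₂ a b c d e).symm
  have d3 : H₃ a d b c e - H₁ a d b c e = H₃ a b c d e - H₁ a b c d e := by
    rw [hD₃ a d b c e, ← h34₃ a b c d e, ← h34 a b c d e]
  have d4 : H₄ a e b c d - H₁ a e b c d = H₄ a b c d e - H₁ a b c d e := by
    rw [hD₄ a e b c d, ← h34₄ a b c e d, ← h34 a b c e d, ← h45₄ a b c d e, ← h45 a b c d e]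
  have hf := hfib a b c d e
  linear_combination hf - d2 - d3 - d4 - hv

/-- The slack's vertex sums vanish: `E(a,b|…) + E(a,c|…) + E(a,d|…) + E(a,e|…) = 0` (= ✓ `closed_vertex_sum`, rearranged; the
pair sum is fully symmetric so the four subtracted pair sums coincide after ✓ `pairSum_cross`-type reorderings). [folklore] -/
theorem slack_vertex_sum (H : Fin 5 → Fin 5 → Fin 5 → Fin 5 → Fin 5 → ℂ)
    (h12 : ∀ a b c d e : Fin 5, H a b c d e = H b a c d e) (h34 : ∀ a b c d e : Fin 5, H a b c d e = H a b d c e)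
    (h45 : ∀ a b c d e : Fin 5, H a b c d e = H a b c e d)
    (hC : ∀ A B C D E : Fin 5, H A B C D E + H A C B D E + H A D C B E + H A E C D B
      = H B A C D E + H B C A D E + H B D C A E + H B E C D A) (a b c d e : Fin 5) :
    (H a b c d e + H a c b d e + H a d b c e + H a e b c d)
      - (2 / 5 : ℂ) * (H a b c d e + H a c b d e + H a d b c e + H a e b c d + H b c a d e + H b d a c e + H b e a c d
          + H c d a b e + H c e a b d + H d e a b c) = 0 := by
  have hv := closed_vertex_sum H h12 h34 h45 hC a b c d e
  linear_combination hv

end LaplaceFiveStar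

end Summit.ValiantsHypothesis.ValiantsHypothesis.Theorems.RigidityForcesSymmetryRankRigidMinimalRepr
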